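import Summits.CriticalPhenomena.PercolationContinuityZ3.Theorems.Transplant.FKConnectivityAllQPat3ShapeThree
import Summits.CriticalPhenomena.PercolationContinuityZ3.Theorems.Transplant.FKConnectivityAllQPat3PairCone
import HarnessLib

/-!
# Connectivity correlation inequalities for `φ_{w,q}`, every `q > 0` — TWO MARKED PIECES ON AN EXPLICIT SKELETON: the composite
# minor's two-level value as a `pairSumC`, the certificate check and the product-cone theorem (census g39 §3/§4 leaf VEE\*; §11 (ii))

Definitions + theorems file (`--supports stmt-CriticalPhenomena-4575`), census lineage (gen 40) of LANE 2's FK sub-programme; builds on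
p205010 (kernel theorem, internal audit signed; external expert review pending).  No named facts, no sorries; standard axioms.

* `FK.side2`, **`FK.shape2X`** (computable) — one colour side of a two-piece shape (skeleton `L` on injective names folded from the
  identity matrix, pieces `1, 2` attached by `FK.attachPat` at `(i₁, j₁)`, `(i₂, j₂)` with mark names `k₁, k₂`; final matrix + level
  corrections) and the TARGET-SIDE TERM in the `pairSumC` format at top level `N`;
* **`FK.lev2C_shape2`** — `lev2C (plainSet p L ∪ E₁ ∪ E₂) (C₁ ∪ C₂) x y s F μ = pairSumC E₁ C₁ E₂ C₂ u₁ v₁ m₁ u₂ v₂ m₂ (shape2X … F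
  (μ + |L| + 2|V|))` (peel piece 2 by `FK.sum_attachPatCC`, piece 1 by `FK.sum_attachPatC`, the skeleton by `FK.sum_plainList_empty`);
* `FK.coefTab2` (coefficient table at residual level `d`), `FK.symm4d`, `FK.shape2X_eq_coefTab2`, `FK.shape2X_eq_zero`,
  `FK.side2_snd_le`, `FK.coefTab2_eq_zero` (nothing above `2|L| + 5`);
* **`FK.certCheck2S coef prods Dn B`** (`Bool`: shifts `≤ B`; rows `d < B + 4`: `4·Σ λ·tensor ≤ Dn·symm4d coef`), `FK.certCheck2S_spec`;
* **`FK.shape2C_nonneg_of_rows`** / **`FK.shape2C_nonneg_of_cert`** — THE PRODUCT-CONE THEOREM: rowwise domination (resp. a passed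
  check) by `Prod2` generators levelwise nonnegative on the two piece minors ⇒ `F ≥ 0` levelwise on the composite minor
  (`4·Dn·lev2C = pairSumC (Dn·symm4 shape2X) ≥ Σ 4λ·pairSumC bterm2 ≥ 0`).  The tabulated (kernel-cheap) front end of the data files
  is in `…Pat3ShapeTwoTab.lean`.
[cite: Grimmett2006, §1.4 eq. (1.20) (p. 15); §3.8 (pp. 61–62)] [cite: AyyerLinussonRavichandran2025, §7 (p. 22)]
-/

namespace Summit.CriticalPhenomena.PercolationContinuityZ3.Theorems

namespace FK

open SimpleGraph Literature.Probability.LatticeModels Literature.Probability.Percolation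
open scoped Classical

variable {V : Type*}

/-! ### Two marked pieces on an explicit skeleton (the t = 2 leaves, e.g. VEE*): the composite as a `pairSumC` and its cone -/

section ShapeTwo

variable [Fintype V] {ι : Type*} [DecidableEq ι]

/-- One colour side of a two-piece shape: skeleton fold, then pieces `1, 2` attached; final matrix + corrections. [folklore] -/
def side2 (L : List (ι × ι)) (i1 j1 k1 i2 j2 k2 : ι) (bs : List Bool) (P1 P2 : Pat3) : (ι → ι → Bool) × ℕ :=
  ((attachPat (attachPat (foldBits (idMat ι) (zipBits L bs)).1 i1 j1 k1 P1) i2 j2 k2 P2),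
    (foldBits (idMat ι) (zipBits L bs)).2 +
      (if (foldBits (idMat ι) (zipBits L bs)).1 i1 j1 && P1.xy then 1 else 0) +
      (if (attachPat (foldBits (idMat ι) (zipBits L bs)).1 i1 j1 k1 P1) i2 j2 && P2.xy then 1 else 0))

/-- **The target-side term of a two-piece shape** in the `pairSumC` format (top level `N = μ + |L| + 2|V|`). [folklore] -/
def shape2X (L : List (ι × ι)) (i1 j1 k1 i2 j2 k2 ix iy is : ι) (F : ℕ → Pat3 → Pat3 → ℤ) (N : ℕ) :
    ℕ → ℕ → Pat3 → Pat3 → Pat3 → Pat3 → ℤ :=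
  fun e1 e2 P1 Q1 P2 Q2 => sumBits L.length fun bs =>
    (if e1 + e2 + ((side2 L i1 j1 k1 i2 j2 k2 bs P1 P2).2 + (side2 L i1 j1 k1 i2 j2 k2 (bs.map (! ·)) Q1 Q2).2) = N then
        F 0 (rdPat ix iy is (side2 L i1 j1 k1 i2 j2 k2 bs P1 P2).1) (rdPat ix iy is (side2 L i1 j1 k1 i2 j2 k2 (bs.map (! ·)) Q1 Q2).1)
      else 0) +
      (if e1 + e2 + ((side2 L i1 j1 k1 i2 j2 k2 bs P1 P2).2 + (side2 L i1 j1 k1 i2 j2 k2 (bs.map (! ·)) Q1 Q2).2) + 1 = N then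
        F 1 (rdPat ix iy is (side2 L i1 j1 k1 i2 j2 k2 bs P1 P2).1) (rdPat ix iy is (side2 L i1 j1 k1 i2 j2 k2 (bs.map (! ·)) Q1 Q2).1)
      else 0)

/-- The coefficient table of a two-piece shape at residual level `d`. Computable. [folklore] -/
def coefTab2 (L : List (ι × ι)) (i1 j1 k1 i2 j2 k2 ix iy is : ι) (F : ℕ → Pat3 → Pat3 → ℤ) (d : ℕ) (P1 Q1 P2 Q2 : Pat3) : ℤ :=
  sumBits L.length fun bs =>
    (if (side2 L i1 j1 k1 i2 j2 k2 bs P1 P2).2 + (side2 L i1 j1 k1 i2 j2 k2 (bs.map (! ·)) Q1 Q2).2 = d then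
        F 0 (rdPat ix iy is (side2 L i1 j1 k1 i2 j2 k2 bs P1 P2).1) (rdPat ix iy is (side2 L i1 j1 k1 i2 j2 k2 (bs.map (! ·)) Q1 Q2).1)
      else 0) +
      (if (side2 L i1 j1 k1 i2 j2 k2 bs P1 P2).2 + (side2 L i1 j1 k1 i2 j2 k2 (bs.map (! ·)) Q1 Q2).2 + 1 = d then
        F 1 (rdPat ix iy is (side2 L i1 j1 k1 i2 j2 k2 bs P1 P2).1) (rdPat ix iy is (side2 L i1 j1 k1 i2 j2 k2 (bs.map (! ·)) Q1 Q2).1)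
      else 0)

/-- The fourfold flip-symmetrisation of a `d`-indexed pair table (term order as `FK.symm4`). [folklore] -/
def symm4d (coef : ℕ → Pat3 → Pat3 → Pat3 → Pat3 → ℤ) (d : ℕ) (P1 Q1 P2 Q2 : Pat3) : ℤ :=
  coef d P1 Q1 P2 Q2 + coef d Q1 P1 P2 Q2 + (coef d P1 Q1 Q2 P2 + coef d Q1 P1 Q2 P2)

omit [Fintype V] in
/-- The target-side term at matching levels is the coefficient table. [folklore] -/
theorem shape2X_eq_coefTab2 (L : List (ι × ι)) (i1 j1 k1 i2 j2 k2 ix iy is : ι) (F : ℕ → Pat3 → Pat3 → ℤ)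
    {N e1 e2 d : ℕ} (hd : e1 + e2 + d = N) (P1 Q1 P2 Q2 : Pat3) :
    shape2X L i1 j1 k1 i2 j2 k2 ix iy is F N e1 e2 P1 Q1 P2 Q2 = coefTab2 L i1 j1 k1 i2 j2 k2 ix iy is F d P1 Q1 P2 Q2 := by
  unfold shape2X coefTab2
  congr 1
  funext bs
  exact lev_pair_congr (by omega) _ _

omit [Fintype V] in
/-- Below the pieces' own levels the target-side term vanishes. [folklore] -/
theorem shape2X_eq_zero (L : List (ι × ι)) (i1 j1 k1 i2 j2 k2 ix iy is : ι) (F : ℕ → Pat3 → Pat3 → ℤ)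
    {N e1 e2 : ℕ} (h : N < e1 + e2) (P1 Q1 P2 Q2 : Pat3) :
    shape2X L i1 j1 k1 i2 j2 k2 ix iy is F N e1 e2 P1 Q1 P2 Q2 = 0 := by
  unfold shape2X
  refine sumBits_eq_zero' L.length fun bs => ?_
  have e1' : ¬ (e1 + e2 + ((side2 L i1 j1 k1 i2 j2 k2 bs P1 P2).2 + (side2 L i1 j1 k1 i2 j2 k2 (bs.map (! ·)) Q1 Q2).2) = N) := by
    omega
  have e2' : ¬ (e1 + e2 + ((side2 L i1 j1 k1 i2 j2 k2 bs P1 P2).2 + (side2 L i1 j1 k1 i2 j2 k2 (bs.map (! ·)) Q1 Q2).2) + 1 = N) := by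
    omega
  rw [if_neg e1', if_neg e2', add_zero]

omit [Fintype V] in
/-- The corrections of one side number at most `|L| + 2`. [folklore] -/
theorem side2_snd_le (L : List (ι × ι)) (i1 j1 k1 i2 j2 k2 : ι) (bs : List Bool) (P1 P2 : Pat3) :
    (side2 L i1 j1 k1 i2 j2 k2 bs P1 P2).2 ≤ L.length + 2 := by
  unfold side2
  have h := (foldBits_snd_le (idMat ι) (zipBits L bs)).trans (length_zipBits_le L bs)
  split_ifs <;> simp only <;> omega

omit [Fintype V] in
/-- The coefficient table vanishes above the structural bound `2|L| + 5`. [folklore] -/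
theorem coefTab2_eq_zero (L : List (ι × ι)) (i1 j1 k1 i2 j2 k2 ix iy is : ι) (F : ℕ → Pat3 → Pat3 → ℤ) {d : ℕ}
    (hd : 2 * L.length + 5 < d) (P1 Q1 P2 Q2 : Pat3) : coefTab2 L i1 j1 k1 i2 j2 k2 ix iy is F d P1 Q1 P2 Q2 = 0 := by
  unfold coefTab2
  refine sumBits_eq_zero' L.length fun bs => ?_
  have h1 := side2_snd_le L i1 j1 k1 i2 j2 k2 bs P1 P2
  have h2 := side2_snd_le L i1 j1 k1 i2 j2 k2 (bs.map (! ·)) Q1 Q2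
  have e1' : ¬ ((side2 L i1 j1 k1 i2 j2 k2 bs P1 P2).2 + (side2 L i1 j1 k1 i2 j2 k2 (bs.map (! ·)) Q1 Q2).2 = d) := by omega
  have e2' : ¬ ((side2 L i1 j1 k1 i2 j2 k2 bs P1 P2).2 + (side2 L i1 j1 k1 i2 j2 k2 (bs.map (! ·)) Q1 Q2).2 + 1 = d) := by omega
  rw [if_neg e1', if_neg e2', add_zero]

/-- **THE CERTIFICATE CHECK of a two-piece shape**: shifts `≤ B`; at every residual level `d < B + 4` and every pattern-pair pair,
`4 · Σ λ · tensor ≤ Dn · symm4d coef`.  A `Bool` for `decide` (`25² · (B + 4)` rows). [folklore] -/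
def certCheck2S (coef : ℕ → Pat3 → Pat3 → Pat3 → Pat3 → ℤ) (prods : List Prod2) (Dn B : ℕ) : Bool :=
  (prods.all fun q => decide (q.shift ≤ B)) &&
    (List.range (B + 4)).all fun d => Pat3.list.all fun P1 => Pat3.list.all fun Q1 => Pat3.list.all fun P2 =>
      Pat3.list.all fun Q2 =>
        decide (4 * (prods.map fun q => (q.lam : ℤ) * q.tensor d P1 Q1 P2 Q2).sum ≤ (Dn : ℤ) * symm4d coef d P1 Q1 P2 Q2)

omit [Fintype V] in
/-- Unpacking a passed two-piece certificate check (all levels). [folklore] -/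
theorem certCheck2S_spec {L : List (ι × ι)} {i1 j1 k1 i2 j2 k2 ix iy is : ι} {F : ℕ → Pat3 → Pat3 → ℤ}
    {prods : List Prod2} {Dn B : ℕ} (hB : 2 * L.length + 2 ≤ B)
    (h : certCheck2S (coefTab2 L i1 j1 k1 i2 j2 k2 ix iy is F) prods Dn B = true) (d : ℕ) (P1 Q1 P2 Q2 : Pat3) :
    4 * (prods.map fun q => (q.lam : ℤ) * q.tensor d P1 Q1 P2 Q2).sum ≤
      (Dn : ℤ) * symm4d (coefTab2 L i1 j1 k1 i2 j2 k2 ix iy is F) d P1 Q1 P2 Q2 := by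
  unfold certCheck2S at h
  rw [Bool.and_eq_true] at h
  obtain ⟨hshift, hmain⟩ := h
  simp only [List.all_eq_true, decide_eq_true_eq] at hshift hmain
  by_cases hd : d < B + 4
  · exact hmain d (List.mem_range.2 hd) P1 P1.mem_list Q1 Q1.mem_list P2 P2.mem_list Q2 Q2.mem_list
  · rw [not_lt] at hd
    have hz : ∀ A1 A2 A3 A4 : Pat3, coefTab2 L i1 j1 k1 i2 j2 k2 ix iy is F d A1 A2 A3 A4 = 0 :=
      fun _ _ _ _ => coefTab2_eq_zero L i1 j1 k1 i2 j2 k2 ix iy is F (by omega) _ _ _ _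
    simp only [symm4d, hz, add_zero, mul_zero]
    refine le_of_eq ?_
    rw [List.sum_eq_zero fun x hx => ?_, mul_zero]
    rw [List.mem_map] at hx
    obtain ⟨q, hq, rfl⟩ := hx
    rw [Prod2.tensor_eq_zero_of_le q (hshift q hq) hd, mul_zero]

variable {p : ι → V} {L : List (ι × ι)} {E₁ C₁ E₂ C₂ : Finset (Sym2 V)} {V₁ V₂ : Set V}
  {u₁ v₁ m₁ u₂ v₂ m₂ x y s : V} {i1 j1 k1 i2 j2 k2 ix iy is : ι}

/-- **THE TWO-LEVEL VALUE OF A TWO-PIECE SHAPE AS A PAIR SUM** (explicit skeleton on injective names; two marked pieces read as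
minors, glued at `(i_b, j_b)` with mark names `k_b`): `lev2C` of the composite minor is the `pairSumC` of `FK.shape2X` at top level
`μ + |L| + 2|V|`. [folklore] -/
theorem lev2C_shape2 (hinj : Function.Injective p)
    (hE1 : ∀ e ∈ (↑(E₁ ∪ C₁) : Set (Sym2 V)), ∀ z ∈ e, z ∈ V₁) (hE2 : ∀ e ∈ (↑(E₂ ∪ C₂) : Set (Sym2 V)), ∀ z ∈ e, z ∈ V₂)
    (hp1 : ∀ a, p a ∈ V₁ → p a = u₁ ∨ p a = v₁ ∨ p a = m₁) (hp2 : ∀ a, p a ∈ V₂ → p a = u₂ ∨ p a = v₂ ∨ p a = m₂)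
    (h12 : ∀ z ∈ V₁, z ∈ V₂ → z = u₂ ∨ z = v₂) (hm1 : m₁ ∈ V₁) (hm2 : m₂ ∈ V₂) (huv1 : u₁ ≠ v₁) (huv2 : u₂ ≠ v₂)
    (hi1 : p i1 = u₁) (hj1 : p j1 = v₁) (hk1 : p k1 = m₁) (hi2 : p i2 = u₂) (hj2 : p j2 = v₂) (hk2 : p k2 = m₂)
    (hk1' : k1 ≠ i1 ∧ k1 ≠ j1) (hk2' : k2 ≠ i2 ∧ k2 ≠ j2) (hx : p ix = x) (hy : p iy = y) (hs : p is = s)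
    (hL : ∀ e ∈ L, p e.1 ≠ p e.2) (hnd : (L.map (pedge p)).Nodup)
    (hLm : ∀ e ∈ L, (p e.1 ≠ m₁ ∧ p e.2 ≠ m₁) ∧ (p e.1 ≠ m₂ ∧ p e.2 ≠ m₂))
    (hd1 : Disjoint (plainSet p L) E₁) (hd2 : Disjoint (plainSet p L ∪ E₁) E₂) (F : ℕ → Pat3 → Pat3 → ℤ) (μ : ℕ) :
    lev2C (plainSet p L ∪ E₁ ∪ E₂) (C₁ ∪ C₂) x y s F μ =
      pairSumC E₁ C₁ E₂ C₂ u₁ v₁ m₁ u₂ v₂ m₂ (shape2X L i1 j1 k1 i2 j2 k2 ix iy is F (μ + L.length + 2 * Fintype.card V)) := by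
  have hmu1 : m₁ ≠ u₁ := by rw [← hk1, ← hi1]; exact fun h => hk1'.1 (hinj h)
  have hmv1 : m₁ ≠ v₁ := by rw [← hk1, ← hj1]; exact fun h => hk1'.2 (hinj h)
  have hmu2 : m₂ ≠ u₂ := by rw [← hk2, ← hi2]; exact fun h => hk2'.1 (hinj h)
  have hmv2 : m₂ ≠ v₂ := by rw [← hk2, ← hj2]; exact fun h => hk2'.2 (hinj h)
  have hmH1 : m₁ ∉ ({z | z ∈ V₁ → z = u₁ ∨ z = v₁} : Set V) := fun h => (h hm1).elim hmu1 hmv1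
  have hmH2 : m₂ ∉ ({z | z ∈ V₂ → z = u₂ ∨ z = v₂} : Set V) := fun h => (h hm2).elim hmu2 hmv2
  have hS1 : ({z | z ∈ V₁ → z = u₁ ∨ z = v₁} : Set V) ∩ V₁ ⊆ {u₁, v₁} := fun z hz => hz.1 hz.2
  have hS2 : ({z | z ∈ V₂ → z = u₂ ∨ z = v₂} : Set V) ∩ V₂ ⊆ {u₂, v₂} := fun z hz => hz.1 hz.2
  have hPL : ∀ e ∈ (↑(plainSet p L) : Set (Sym2 V)), ∀ z ∈ e, ∃ f ∈ L, z = p f.1 ∨ z = p f.2 := by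
    intro e he z hz
    rw [Finset.mem_coe] at he; unfold plainSet at he; rw [List.mem_toFinset, List.mem_map] at he
    obtain ⟨f, hf, rfl⟩ := he
    exact ⟨f, hf, Sym2.mem_iff.1 hz⟩
  have hPL1 : ∀ e ∈ (↑(plainSet p L) : Set (Sym2 V)), ∀ z ∈ e, z ∈ ({z | z ∈ V₁ → z = u₁ ∨ z = v₁} : Set V) := by
    intro e he z hz hzV
    obtain ⟨f, hf, hz'⟩ := hPL e he z hz
    rcases hz' with rfl | rfl
    · rcases hp1 f.1 hzV with h | h | h
      · exact Or.inl h
      · exact Or.inr h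
      · exact absurd h (hLm f hf).1.1
    · rcases hp1 f.2 hzV with h | h | h
      · exact Or.inl h
      · exact Or.inr h
      · exact absurd h (hLm f hf).1.2
  have hPL2 : ∀ e ∈ (↑(plainSet p L) : Set (Sym2 V)), ∀ z ∈ e, z ∈ ({z | z ∈ V₂ → z = u₂ ∨ z = v₂} : Set V) := by
    intro e he z hz hzV
    obtain ⟨f, hf, hz'⟩ := hPL e he z hz
    rcases hz' with rfl | rfl
    · rcases hp2 f.1 hzV with h | h | h
      · exact Or.inl h
      · exact Or.inr h
      · exact absurd h (hLm f hf).2.1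
    · rcases hp2 f.2 hzV with h | h | h
      · exact Or.inl h
      · exact Or.inr h
      · exact absurd h (hLm f hf).2.2
  have hH2 : ∀ e ∈ (↑(plainSet p L ∪ E₁ ∪ C₁) : Set (Sym2 V)), ∀ z ∈ e, z ∈ ({z | z ∈ V₂ → z = u₂ ∨ z = v₂} : Set V) := by
    intro e he z hz
    rw [Finset.coe_union, Finset.coe_union, Set.union_assoc] at he
    rcases he with he | he
    · exact hPL2 e he z hz
    · rw [← Finset.coe_union] at he
      exact fun hzV => h12 z (hE1 e he z hz) hzV
  set g : ℕ → (ι → ι → Bool) → (ι → ι → Bool) → ℤ := fun n A B =>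
    (if n = μ + 4 * Fintype.card V + L.length then F 0 (rdPat ix iy is A) (rdPat ix iy is B) else 0) +
      (if n + 1 = μ + 4 * Fintype.card V + L.length then F 1 (rdPat ix iy is A) (rdPat ix iy is B) else 0) with hg
  unfold lev2C
  rw [Finset.sum_congr rfl fun γ _ => show
      ((if apExpC (plainSet p L ∪ E₁ ∪ E₂) (C₁ ∪ C₂) γ = μ then
          F 0 (pat3 (γ ∪ (C₁ ∪ C₂)) x y s) (pat3 ((plainSet p L ∪ E₁ ∪ E₂) \ γ ∪ (C₁ ∪ C₂)) x y s) else 0) +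
        (if apExpC (plainSet p L ∪ E₁ ∪ E₂) (C₁ ∪ C₂) γ + 1 = μ then
          F 1 (pat3 (γ ∪ (C₁ ∪ C₂)) x y s) (pat3 ((plainSet p L ∪ E₁ ∪ E₂) \ γ ∪ (C₁ ∪ C₂)) x y s) else 0)) =
      g (apExpC (plainSet p L ∪ E₁ ∪ E₂) (C₁ ∪ C₂) γ + 2 * Fintype.card V + (2 * Fintype.card V + L.length))
        (cmat p (γ ∪ (C₁ ∪ C₂))) (cmat p ((plainSet p L ∪ E₁ ∪ E₂) \ γ ∪ (C₁ ∪ C₂))) by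
    simp only [hg, rdPat, ← pat3_eq_ofBits_cmat p _ hx hy hs]
    exact lev_pair_congr (by omega) _ _]
  -- peel piece 2 (host = skeleton ∪ 1, contracted `C₁`)
  rw [sum_attachPatCC hd2 hH2 hE2 hS2 huv2 hmH2 hmu2 hmv2 hp2 hi2 hj2 hk2 (2 * Fintype.card V + L.length) g, Finset.sum_comm]
  -- peel piece 1 inside (host = skeleton)
  have peel1 := fun (γ₂ : Finset (Sym2 V)) =>
    sum_attachPatC hd1 hPL1 hE1 hS1 huv1 hmH1 hmu1 hmv1 hp1 hi1 hj1 hk1 (L.length + apExpC E₂ C₂ γ₂)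
      (fun n A B => g (n + (if A i2 j2 && (pat3 (γ₂ ∪ C₂) u₂ v₂ m₂).xy then 1 else 0) +
          (if B i2 j2 && (pat3 (E₂ \ γ₂ ∪ C₂) u₂ v₂ m₂).xy then 1 else 0))
        (attachPat A i2 j2 k2 (pat3 (γ₂ ∪ C₂) u₂ v₂ m₂)) (attachPat B i2 j2 k2 (pat3 (E₂ \ γ₂ ∪ C₂) u₂ v₂ m₂)))
  rw [Finset.sum_congr rfl fun γ₂ _ => ((Finset.sum_congr rfl fun γ' _ => by congr 1; omega).trans
    ((peel1 γ₂).trans Finset.sum_comm))]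
  -- the skeleton down to the edgeless host
  have peel0 := fun (γ₂ γ₁ : Finset (Sym2 V)) =>
    sum_plainList_empty hinj L hL hnd (apExpC E₂ C₂ γ₂ + apExpC E₁ C₁ γ₁)
      (fun n A B => g (n +
          (if (attachPat A i1 j1 k1 (pat3 (γ₁ ∪ C₁) u₁ v₁ m₁)) i2 j2 && (pat3 (γ₂ ∪ C₂) u₂ v₂ m₂).xy then 1 else 0) +
          (if (attachPat B i1 j1 k1 (pat3 (E₁ \ γ₁ ∪ C₁) u₁ v₁ m₁)) i2 j2 && (pat3 (E₂ \ γ₂ ∪ C₂) u₂ v₂ m₂).xy then 1 else 0) +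
          (if A i1 j1 && (pat3 (γ₁ ∪ C₁) u₁ v₁ m₁).xy then 1 else 0) +
          (if B i1 j1 && (pat3 (E₁ \ γ₁ ∪ C₁) u₁ v₁ m₁).xy then 1 else 0))
        (attachPat (attachPat A i1 j1 k1 (pat3 (γ₁ ∪ C₁) u₁ v₁ m₁)) i2 j2 k2 (pat3 (γ₂ ∪ C₂) u₂ v₂ m₂))
        (attachPat (attachPat B i1 j1 k1 (pat3 (E₁ \ γ₁ ∪ C₁) u₁ v₁ m₁)) i2 j2 k2 (pat3 (E₂ \ γ₂ ∪ C₂) u₂ v₂ m₂)))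
  rw [Finset.sum_congr rfl fun γ₂ _ => Finset.sum_congr rfl fun γ₁ _ =>
    ((Finset.sum_congr rfl fun γ₀ _ => by congr 1; omega).trans (peel0 γ₂ γ₁))]
  -- reorder and match
  unfold pairSumC shape2X
  rw [Finset.sum_comm]
  refine Finset.sum_congr rfl fun γ₁ _ => Finset.sum_congr rfl fun γ₂ _ => ?_
  congr 1
  funext bs
  simp only [hg, side2]
  exact lev_pair_congr (by omega) _ _

/-- **THE PRODUCT-CONE THEOREM FOR TWO-PIECE SHAPES, rowwise form** (the t = 2 K₄ leaf VEE\* of census g39 §3/§4, in census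
g37's minors form): rowwise domination `4·Σ λ·tensor ≤ Dn·symm4d (coefTab2 …)` by `Prod2` generators levelwise nonnegative on the two
piece minors gives `F` levelwise nonnegative on the composite minor.  (`4·Dn·lev2C = Σ Dn·symm4d ≥ Σ 4·λ·tensor`; product side by
`FK.pairSumC_bterm2_nonneg`.)  Front ends: `FK.shape2C_nonneg_of_cert` (direct check) and the tabulated check of the data files.
[cite: AyyerLinussonRavichandran2025, §7 (p. 22)] -/
theorem shape2C_nonneg_of_rows (hinj : Function.Injective p)
    (hE1 : ∀ e ∈ (↑(E₁ ∪ C₁) : Set (Sym2 V)), ∀ z ∈ e, z ∈ V₁) (hE2 : ∀ e ∈ (↑(E₂ ∪ C₂) : Set (Sym2 V)), ∀ z ∈ e, z ∈ V₂)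
    (hp1 : ∀ a, p a ∈ V₁ → p a = u₁ ∨ p a = v₁ ∨ p a = m₁) (hp2 : ∀ a, p a ∈ V₂ → p a = u₂ ∨ p a = v₂ ∨ p a = m₂)
    (h12 : ∀ z ∈ V₁, z ∈ V₂ → z = u₂ ∨ z = v₂) (hm1 : m₁ ∈ V₁) (hm2 : m₂ ∈ V₂) (huv1 : u₁ ≠ v₁) (huv2 : u₂ ≠ v₂)
    (hi1 : p i1 = u₁) (hj1 : p j1 = v₁) (hk1 : p k1 = m₁) (hi2 : p i2 = u₂) (hj2 : p j2 = v₂) (hk2 : p k2 = m₂)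
    (hk1' : k1 ≠ i1 ∧ k1 ≠ j1) (hk2' : k2 ≠ i2 ∧ k2 ≠ j2) (hx : p ix = x) (hy : p iy = y) (hs : p is = s)
    (hL : ∀ e ∈ L, p e.1 ≠ p e.2) (hnd : (L.map (pedge p)).Nodup)
    (hLm : ∀ e ∈ L, (p e.1 ≠ m₁ ∧ p e.2 ≠ m₁) ∧ (p e.1 ≠ m₂ ∧ p e.2 ≠ m₂))
    (hd1 : Disjoint (plainSet p L) E₁) (hd2 : Disjoint (plainSet p L ∪ E₁) E₂) (F : ℕ → Pat3 → Pat3 → ℤ)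
    {prods : List Prod2} {Dn : ℕ} (hDn : 0 < Dn)
    (hrow : ∀ d P1 Q1 P2 Q2, 4 * (prods.map fun q => (q.lam : ℤ) * q.tensor d P1 Q1 P2 Q2).sum ≤
      (Dn : ℤ) * symm4d (coefTab2 L i1 j1 k1 i2 j2 k2 ix iy is F) d P1 Q1 P2 Q2)
    (hval : ∀ q ∈ prods, ∀ ν : ℕ, 0 ≤ lev2C E₁ C₁ u₁ v₁ m₁ q.g1 ν ∧ 0 ≤ lev2C E₂ C₂ u₂ v₂ m₂ q.g2 ν) (μ : ℕ) :
    0 ≤ lev2C (plainSet p L ∪ E₁ ∪ E₂) (C₁ ∪ C₂) x y s F μ := by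
  set N := μ + L.length + 2 * Fintype.card V with hN
  have e1 := lev2C_shape2 hinj hE1 hE2 hp1 hp2 h12 hm1 hm2 huv1 huv2 hi1 hj1 hk1 hi2 hj2 hk2 hk1' hk2' hx hy hs hL hnd hLm
    hd1 hd2 F μ
  have e4 : 4 * ((Dn : ℤ) * lev2C (plainSet p L ∪ E₁ ∪ E₂) (C₁ ∪ C₂) x y s F μ) =
      (Dn : ℤ) * pairSumC E₁ C₁ E₂ C₂ u₁ v₁ m₁ u₂ v₂ m₂ (symm4 (shape2X L i1 j1 k1 i2 j2 k2 ix iy is F N)) := by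
    rw [e1, ← pairSumC_symm4]; ring
  have step2 : ∀ e1 e2 P1 Q1 P2 Q2,
      4 * ∑ j : Fin prods.length, ((prods.get j).lam : ℤ) * bterm2 (prods.get j) N e1 e2 P1 Q1 P2 Q2 ≤
        (Dn : ℤ) * symm4 (shape2X L i1 j1 k1 i2 j2 k2 ix iy is F N) e1 e2 P1 Q1 P2 Q2 := by
    intro e1 e2 P1 Q1 P2 Q2
    by_cases hle : e1 + e2 ≤ N
    · obtain ⟨d, hd⟩ := Nat.exists_eq_add_of_le hle
      have hd' : e1 + e2 + d = N := hd.symm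
      have hx' : symm4 (shape2X L i1 j1 k1 i2 j2 k2 ix iy is F N) e1 e2 P1 Q1 P2 Q2 =
          symm4d (coefTab2 L i1 j1 k1 i2 j2 k2 ix iy is F) d P1 Q1 P2 Q2 := by
        simp only [symm4, symm4d, shape2X_eq_coefTab2 L i1 j1 k1 i2 j2 k2 ix iy is F hd']
      rw [hx', Finset.sum_congr rfl fun j _ => by rw [bterm2_eq_tensor (prods.get j) hd'],
        ← list_sum_eq_finset_sum2 prods (fun q => (q.lam : ℤ) * q.tensor d P1 Q1 P2 Q2)]
      exact hrow d P1 Q1 P2 Q2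
    · rw [not_le] at hle
      have hx' : symm4 (shape2X L i1 j1 k1 i2 j2 k2 ix iy is F N) e1 e2 P1 Q1 P2 Q2 = 0 := by
        simp only [symm4, shape2X_eq_zero L i1 j1 k1 i2 j2 k2 ix iy is F hle, add_zero]
      rw [hx', mul_zero, Finset.sum_eq_zero fun j _ => by rw [bterm2_eq_zero (prods.get j) hle, mul_zero], mul_zero]
  have main : 0 ≤ 4 * ((Dn : ℤ) * lev2C (plainSet p L ∪ E₁ ∪ E₂) (C₁ ∪ C₂) x y s F μ) := by
    rw [e4, ← pairSumC_const_mul]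
    refine le_trans ?_ (pairSumC_mono E₁ C₁ E₂ C₂ u₁ v₁ m₁ u₂ v₂ m₂ step2)
    rw [pairSumC_const_mul, pairSumC_finset_sum]
    refine mul_nonneg (by norm_num) (Finset.sum_nonneg fun j _ => ?_)
    rw [pairSumC_const_mul]
    exact mul_nonneg (Nat.cast_nonneg _)
      (pairSumC_bterm2_nonneg E₁ C₁ E₂ C₂ u₁ v₁ m₁ u₂ v₂ m₂ (prods.get j) N (hval _ (List.get_mem prods j)))
  have hDn' : (0 : ℤ) < Dn := by exact_mod_cast hDn
  nlinarith

/-- **THE PRODUCT-CONE THEOREM FOR TWO-PIECE SHAPES** via the direct certificate check `FK.certCheck2S`.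
[cite: AyyerLinussonRavichandran2025, §7 (p. 22)] -/
theorem shape2C_nonneg_of_cert (hinj : Function.Injective p)
    (hE1 : ∀ e ∈ (↑(E₁ ∪ C₁) : Set (Sym2 V)), ∀ z ∈ e, z ∈ V₁) (hE2 : ∀ e ∈ (↑(E₂ ∪ C₂) : Set (Sym2 V)), ∀ z ∈ e, z ∈ V₂)
    (hp1 : ∀ a, p a ∈ V₁ → p a = u₁ ∨ p a = v₁ ∨ p a = m₁) (hp2 : ∀ a, p a ∈ V₂ → p a = u₂ ∨ p a = v₂ ∨ p a = m₂)
    (h12 : ∀ z ∈ V₁, z ∈ V₂ → z = u₂ ∨ z = v₂) (hm1 : m₁ ∈ V₁) (hm2 : m₂ ∈ V₂) (huv1 : u₁ ≠ v₁) (huv2 : u₂ ≠ v₂)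
    (hi1 : p i1 = u₁) (hj1 : p j1 = v₁) (hk1 : p k1 = m₁) (hi2 : p i2 = u₂) (hj2 : p j2 = v₂) (hk2 : p k2 = m₂)
    (hk1' : k1 ≠ i1 ∧ k1 ≠ j1) (hk2' : k2 ≠ i2 ∧ k2 ≠ j2) (hx : p ix = x) (hy : p iy = y) (hs : p is = s)
    (hL : ∀ e ∈ L, p e.1 ≠ p e.2) (hnd : (L.map (pedge p)).Nodup)
    (hLm : ∀ e ∈ L, (p e.1 ≠ m₁ ∧ p e.2 ≠ m₁) ∧ (p e.1 ≠ m₂ ∧ p e.2 ≠ m₂))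
    (hd1 : Disjoint (plainSet p L) E₁) (hd2 : Disjoint (plainSet p L ∪ E₁) E₂) (F : ℕ → Pat3 → Pat3 → ℤ)
    {prods : List Prod2} {Dn B : ℕ} (hDn : 0 < Dn) (hB : 2 * L.length + 2 ≤ B)
    (hc : certCheck2S (coefTab2 L i1 j1 k1 i2 j2 k2 ix iy is F) prods Dn B = true)
    (hval : ∀ q ∈ prods, ∀ ν : ℕ, 0 ≤ lev2C E₁ C₁ u₁ v₁ m₁ q.g1 ν ∧ 0 ≤ lev2C E₂ C₂ u₂ v₂ m₂ q.g2 ν) (μ : ℕ) :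
    0 ≤ lev2C (plainSet p L ∪ E₁ ∪ E₂) (C₁ ∪ C₂) x y s F μ :=
  shape2C_nonneg_of_rows hinj hE1 hE2 hp1 hp2 h12 hm1 hm2 huv1 huv2 hi1 hj1 hk1 hi2 hj2 hk2 hk1' hk2' hx hy hs hL hnd hLm hd1 hd2 F
    hDn (certCheck2S_spec hB hc) hval μ

end ShapeTwo

end FK

end Summit.CriticalPhenomena.PercolationContinuityZ3.Theorems
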